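import Literature.NumberTheory.EllipticCurves.IwasawaAlgebraDivisibilityProofs
import Literature.NumberTheory.EllipticCurves.KatoRankBound
import Literature.NumberTheory.EllipticCurves.PAdicBSD
import Literature.NumberTheory.EllipticCurves.IwasawaOrderOfVanishing
import Literature.NumberTheory.EllipticCurves.PAdicLFunctionNeZeroHoldsProofs
import HarnessLib

/-!
# Kato's divisibility `char_Λ X(E/ℚ_∞) ∣ p^n L_p(E,T)`: the algebra of Astérisque 295, §17.13

K. Kato, *`p`-adic Hodge theory and values of zeta functions of modular forms*, Astérisque 295
(2004), proves Thm. 17.4 (p. 273) —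

> **Theorem 17.4.** Assume `f` has good ordinary reduction at `λ`. Let `T` be a
> `Gal(ℚ̄/ℚ)`-stable `O_λ`-lattice of `V_{F_λ}(f)`. (1) `X(T)` is a torsion `Λ`-module.
> (2) … `L_{p-adic,α,ω,γ}(f) ∈ Λ ⊗ ℚ`, and `length_{Λ_𝔭}(X(T)_𝔭) ≤ ord_𝔭(L_{p-adic,α,ω,γ}(f))`
> for any prime ideal `𝔭` in `Λ` of height one which does not contain `p`.

— in §17.13 (pp. 279–280) by pure module theory from four cohomological inputs: the Poitou–Tate
exact sequence (17.13.1) `0 → H¹(T(k))/(lim H¹_f) → H¹_loc(T(k))/(lim H¹_f) → X(T*(1-k)) →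
H²(T(k)) → H²_loc(T(k))`; Thm. 12.4 (p. 221: `H²(T)` is `Λ`-torsion; `H¹(T)` is torsion free and
`H¹(T) ⊗ ℚ` is free of rank one); Prop. 17.11 with Thm. 16.6 (pp. 277, 280: the Perrin-Riou /
Coleman map induces an injection `H¹_loc(T(k))/H¹_loc(T'(k)) ↪ Λ` with finite cokernel "which
sends the image of `Z(f,T)(k)_𝔭` onto `Λ_𝔭 · L_{p-adic,α,ω,γ}(f)`"); and the Euler-system bound
Thm. 12.5 (3) (p. 222: `length_{Λ_𝔭}(H²_𝔭) ≤ length_{Λ_𝔭}(H¹_𝔭/Z(f)_𝔭) + length_{Λ_𝔭}(H²_{loc,𝔭})`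
for height-one `𝔭 ∌ p`, the last term vanishing when `f` is potentially of good reduction at `p`).
None of these four inputs is expressible in the tree today (no Iwasawa cohomology, no Coleman
map, no zeta elements), and they are NOT assumed here as named facts. This file PROVES the
module theory of §17.13 with the four inputs as explicit hypotheses on abstract `Λ`-modules
`H` (`= H¹`), `P` (`= H¹_loc/H¹_loc(T')`), `X`, `H2` (`= H²`), so that the tree's named fact
`Literature.NumberTheory.EllipticCurves.kato_divisibility` (conclusions 1–2 = Thm. 17.4 (1)–(2) for `T = T_pE(-1)`) is reduced,
by theorems, to exactly those inputs:

* `Kato2004.loc_injective` — (17.13.2): `lim H¹_f = 0`, i.e. `H → P` is injective, from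
  "`H¹` torsion free of rank 1" and "the image of the zeta elements is already of rank 1"
  (`Module.injective_of_rank_le_one`).
* `Kato2004.isTorsion_of_skeleton` — Thm. 17.4 (1): `X` is torsion (`P/loc(H)` is killed by the
  image `G ≠ 0` of a zeta element, `H²` is torsion).
* `Kato2004.lengthAt_le_of_skeleton` — Thm. 17.4 (2) at one prime `𝔭`: if
  `length H²_𝔭 ≤ length (H/Z)_𝔭` then `length X_𝔭 ≤ length (Λ/(G))_𝔭`, by additivity of lengths
  along `0 → H/Z → P/loc Z → P/loc H → 0` and `P/loc H ↪ X ↠ im ⊆ H²`, and `P/loc Z ↪ Λ/col loc Z ↞ Λ/(G)`.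
* `Kato2004.thm17_4_skeleton` — the conjunction, in Kato's printed (length) form, over any domain.
* `Kato2004.exists_mem_charIdeal_of_skeleton` — over `Λ = ℤ_p⟦T⟧`, the tree's form
  "`X` torsion and `p^m L ∈ ι(char_Λ X)`", via the bridge
  `Module.exists_pow_mul_mem_charIdeal_of_lengthAt_le` (file `IwasawaAlgebraDivisibilityProofs`).
* `Kato2004.kato_divisibility_conclusions_of_skeleton` — for a Pontryagin-dual datum
  `D : W.SelmerDualData κ γ` and `L = L_p(E,T)`: literally conclusions 1–2 of `kato_divisibility`
  (`G ≠ 0` being supplied by the tree THEOREM `padicLFunction_unitRoot_ne_zero`, Rohrlich).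
* `kato_mordellWeilRank_le_order_padicLFunction_of_thm17_4` — the vendored Thm. 18.4 (rank form,
  `Literature.NumberTheory.EllipticCurves.kato_mordellWeilRank_le_order_padicLFunction`) from conclusions 1–2 ALONE (conclusion 3
  of `kato_divisibility`, the integral refinement under surjectivity of `ρ_{E,p}`, is not on its
  critical path), by the tree theorem
  `WeierstrassCurve.mordellWeilRank_le_order_of_mem_charIdeal_of_isCyclotomic`;
  `kato_divisibility.thm17_4` records that the tree's fact implies these conclusions.

What is deliberately NOT here: any definition of `H¹(T)`, `H¹_loc`, the Coleman map or zeta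
elements, and any new named fact (D-0026); the exactness "up to `×2`" for `p = 2` in (17.13.1)
(the consumers assume `p ≠ 2`); the finiteness of the cokernel in Prop. 17.11 and of `H²_loc`
(17.13.4), which Kato uses to obtain EQUALITIES of lengths but which the INEQUALITY 17.4 (2) does
not need (only injectivity of the Coleman map and `length(im δ) ≤ length H²` are used).

References: K. Kato, Astérisque 295 (2004), Thms 12.4–12.5 (pp. 221–222), Thm. 16.6, Prop. 17.11,
§17.13 (pp. 277–280), Thm. 17.4 (p. 273), Thm. 18.4 (p. 281); K. Rubin, *Euler Systems*, Ann.
Math. Stud. 147, Thms 2.3.3–2.3.4 (the same skeleton for a general Euler system). -/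

noncomputable section

open scoped MatrixGroups ModularForm

open CongruenceSubgroup Literature.NumberTheory.EllipticCurves.ModularForms

namespace Literature.NumberTheory.EllipticCurves

namespace Kato2004

open Module

/-! ### §17.13 over an arbitrary domain -/

section Skeleton

variable {R : Type*} [CommRing R] [IsDomain R]
  {H P X H2 : Type*} [AddCommGroup H] [_root_.Module R H] [AddCommGroup P] [_root_.Module R P]
  [AddCommGroup X] [_root_.Module R X] [AddCommGroup H2] [_root_.Module R H2]

/-- A non-zero `G = col (loc z)` makes `loc z` a non-torsion element. [folklore] -/
theorem smul_eq_zero_imp_of_col (loc : H →ₗ[R] P) (col : P →ₗ[R] R) {z : H} {G : R}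
    (hG : G ≠ 0) (hz : col (loc z) = G) (a : R) (ha : a • loc z = 0) : a = 0 := by
  have : a * G = 0 := by rw [← hz, ← smul_eq_mul, ← map_smul, ha, map_zero]
  exact (mul_eq_zero.mp this).resolve_right hG

/-- **(17.13.2): `lim H¹_f = 0`.** If `H` (`= H¹(T(k))`) is torsion free of rank `≤ 1`
(Thm. 12.4 (2)) and some `z ∈ H` has `col (loc z) = G ≠ 0` (Thm. 16.6 with Prop. 17.11: the image
of the zeta elements "is already of `Λ`-rank 1"), then `loc : H → P` is injective
(Kato, §17.13, p. 279). [cite: Kato2004, §17.13 (p. 279)] -/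
theorem loc_injective [Module.IsTorsionFree R H] (hrank : Module.rank R H ≤ 1)
    (loc : H →ₗ[R] P) (col : P →ₗ[R] R) {z : H} {G : R} (hG : G ≠ 0) (hz : col (loc z) = G) :
    Function.Injective loc :=
  injective_of_rank_le_one hrank loc z (smul_eq_zero_imp_of_col loc col hG hz)

omit [IsDomain R] in
/-- `P / loc(H)` is killed by `G = col (loc z)` when `col` is injective: for `y ∈ P`,
`col (G • y - col(y) • loc z) = 0`. [cite: Kato2004, §17.13 (p. 280)] -/
theorem isTorsionBy_quotient_range (loc : H →ₗ[R] P) (col : P →ₗ[R] R)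
    (hcol : Function.Injective col) {z : H} {G : R} (hz : col (loc z) = G) :
    Module.IsTorsionBy R (P ⧸ LinearMap.range loc) G := by
  intro q
  obtain ⟨y, rfl⟩ := Submodule.Quotient.mk_surjective _ q
  rw [← Submodule.Quotient.mk_smul, Submodule.Quotient.mk_eq_zero]
  refine ⟨col y • z, ?_⟩
  apply hcol
  simp only [map_smul, hz, smul_eq_mul, mul_comm]

/-- **Thm. 17.4 (1), skeleton.** With `H →loc P →toX X →δ H2` exact at `P` and at `X`
((17.13.1)), `col : P ↪ R` injective (Prop. 17.11), `col (loc z) = G ≠ 0` (Thm. 16.6) and `H2`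
torsion (Thm. 12.4 (1)), the module `X` is torsion: it is an extension of a submodule of `H2` by
the quotient `P/loc(H)`, which is killed by `G`. [cite: Kato2004, Thm 17.4 (1) and §17.13 (p. 280)] -/
theorem isTorsion_of_skeleton (loc : H →ₗ[R] P) (toX : P →ₗ[R] X) (δ : X →ₗ[R] H2)
    (hPX : Function.Exact loc toX) (hXH : Function.Exact toX δ)
    (col : P →ₗ[R] R) (hcol : Function.Injective col) {z : H} {G : R} (hG : G ≠ 0)
    (hz : col (loc z) = G) (hH2 : Module.IsTorsion R H2) : Module.IsTorsion R X := by
  -- `toX` factors through `P / range loc`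
  have hle : LinearMap.range loc ≤ LinearMap.ker toX := by
    rintro _ ⟨x, rfl⟩; exact (hPX (loc x)).mpr ⟨x, rfl⟩
  let f : (P ⧸ LinearMap.range loc) →ₗ[R] X := (LinearMap.range loc).liftQ toX hle
  have hf : Function.Exact f δ := by
    intro y
    rw [hXH y]
    constructor
    · rintro ⟨x, rfl⟩; exact ⟨Submodule.Quotient.mk x, rfl⟩
    · rintro ⟨q, rfl⟩
      obtain ⟨x, rfl⟩ := Submodule.Quotient.mk_surjective _ q
      exact ⟨x, rfl⟩
  refine isTorsion_of_exact f δ hf ?_ hH2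
  intro q
  exact ⟨⟨G, mem_nonZeroDivisors_of_ne_zero hG⟩, isTorsionBy_quotient_range loc col hcol hz (x := q)⟩

/-- **Thm. 17.4 (2) at one prime, skeleton.** In the situation of `isTorsion_of_skeleton`, with
`H` torsion free of rank `≤ 1` (Thm. 12.4 (2)), `Z ≤ H` the submodule of zeta elements and
`G ∈ col (loc Z)`, `G ≠ 0` (Thm. 16.6, Prop. 17.11): at every prime `𝔭` of `R` where the
Euler-system bound `length H2_𝔭 ≤ length (H/Z)_𝔭` holds (Thm. 12.5 (3)), one has
`length X_𝔭 ≤ length (R/(G))_𝔭` — Kato's "`length_{Λ_𝔭}(X_𝔭) ≤ ord_𝔭(L)`". The proof is the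
length bookkeeping of §17.13 (p. 280): `length X ≤ length (P/loc H) + length H2`,
`length (P/loc Z) = length (H/Z) + length (P/loc H)` (`loc` injective, (17.13.2)), and
`P/loc Z ↪ R/col(loc Z) ↞ R/(G)`. [cite: Kato2004, Thm 17.4 (2) and §17.13 (pp. 279–280)] -/
theorem lengthAt_le_of_skeleton [Module.IsTorsionFree R H] (hrank : Module.rank R H ≤ 1)
    (loc : H →ₗ[R] P) (toX : P →ₗ[R] X) (δ : X →ₗ[R] H2)
    (hPX : Function.Exact loc toX) (hXH : Function.Exact toX δ)
    (col : P →ₗ[R] R) (hcol : Function.Injective col) (Z : Submodule R H) {G : R} (hG : G ≠ 0)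
    (hGZ : G ∈ Submodule.map (col ∘ₗ loc) Z) (𝔭 : PrimeSpectrum R)
    (hES : lengthAt R H2 𝔭 ≤ lengthAt R (H ⧸ Z) 𝔭) :
    lengthAt R X 𝔭 ≤ lengthAt R (R ⧸ Ideal.span {G}) 𝔭 := by
  obtain ⟨z, hzZ, hz⟩ := Submodule.mem_map.mp hGZ
  simp only [LinearMap.coe_comp, Function.comp_apply] at hz
  have hinj : Function.Injective loc := loc_injective hrank loc col hG hz
  -- `toX` factors through `Q₁ = P / range loc`, and `X` sits in `Q₁ → X → H2`
  have hle : LinearMap.range loc ≤ LinearMap.ker toX := by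
    rintro _ ⟨x, rfl⟩; exact (hPX (loc x)).mpr ⟨x, rfl⟩
  let f : (P ⧸ LinearMap.range loc) →ₗ[R] X := (LinearMap.range loc).liftQ toX hle
  have hf : Function.Exact f δ := by
    intro y
    rw [hXH y]
    constructor
    · rintro ⟨x, rfl⟩; exact ⟨Submodule.Quotient.mk x, rfl⟩
    · rintro ⟨q, rfl⟩
      obtain ⟨x, rfl⟩ := Submodule.Quotient.mk_surjective _ q
      exact ⟨x, rfl⟩
  have h1 : lengthAt R X 𝔭 ≤ lengthAt R (P ⧸ LinearMap.range loc) 𝔭 + lengthAt R H2 𝔭 :=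
    lengthAt_le_add_of_exact f δ hf 𝔭
  -- `Q = P / loc Z` has length `length (H/Z) + length (P / range loc)`
  set LZ : Submodule R P := Submodule.map loc Z with hLZ
  have hLZle : LZ ≤ LinearMap.range loc := LinearMap.map_le_range
  -- the image `N` of `range loc` in `Q`
  set N : Submodule R (P ⧸ LZ) := Submodule.map LZ.mkQ (LinearMap.range loc) with hN
  have hQN : lengthAt R (P ⧸ LZ) 𝔭 = lengthAt R N 𝔭 + lengthAt R ((P ⧸ LZ) ⧸ N) 𝔭 :=
    lengthAt_eq_add_quotient N 𝔭
  -- `(P/LZ)/N ≃ P / range loc`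
  have hthird : lengthAt R ((P ⧸ LZ) ⧸ N) 𝔭 = lengthAt R (P ⧸ LinearMap.range loc) 𝔭 :=
    lengthAt_eq_of_linearEquiv (Submodule.quotientQuotientEquivQuotient LZ _ hLZle) 𝔭
  -- `N ≃ H / Z`: `N` is the range of `mkQ ∘ loc`, whose kernel is `Z` (`loc` injective)
  have hNeq : lengthAt R N 𝔭 = lengthAt R (H ⧸ Z) 𝔭 := by
    set g : H →ₗ[R] P ⧸ LZ := LZ.mkQ ∘ₗ loc with hg
    have hrange : LinearMap.range g = N := by
      rw [hg, LinearMap.range_comp, hN]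
    have hker : LinearMap.ker g = Z := by
      rw [hg, LinearMap.ker_comp, Submodule.ker_mkQ, hLZ, Submodule.comap_map_eq_of_injective hinj]
    calc lengthAt R N 𝔭 = lengthAt R (LinearMap.range g) 𝔭 := by rw [hrange]
      _ = lengthAt R (H ⧸ LinearMap.ker g) 𝔭 := (lengthAt_eq_of_linearEquiv g.quotKerEquivRange 𝔭).symm
      _ = lengthAt R (H ⧸ Z) 𝔭 := by rw [hker]
  -- `P / LZ ↪ R / col(LZ)` and `R/(G) ↠ R / col(LZ)`
  set I : Ideal R := Submodule.map col LZ with hI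
  have hGI : G ∈ I := ⟨loc z, ⟨z, hzZ, rfl⟩, hz⟩
  have hQI : lengthAt R (P ⧸ LZ) 𝔭 ≤ lengthAt R (R ⧸ I) 𝔭 := by
    refine lengthAt_le_of_injective (Submodule.mapQ LZ I col fun y hy => ⟨y, hy, rfl⟩) ?_ 𝔭
    rw [← LinearMap.ker_eq_bot, Submodule.ker_mapQ, Submodule.comap_map_eq_of_injective hcol,
      Submodule.mkQ_map_self]
  have hIG : lengthAt R (R ⧸ I) 𝔭 ≤ lengthAt R (R ⧸ Ideal.span {G}) 𝔭 :=
    lengthAt_le_of_surjective (Submodule.factor ((Ideal.span_singleton_le_iff_mem I).mpr hGI))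
      (Submodule.factor_surjective _) 𝔭
  -- assemble
  calc lengthAt R X 𝔭 ≤ lengthAt R (P ⧸ LinearMap.range loc) 𝔭 + lengthAt R H2 𝔭 := h1
    _ ≤ lengthAt R (P ⧸ LinearMap.range loc) 𝔭 + lengthAt R (H ⧸ Z) 𝔭 := add_le_add le_rfl hES
    _ = lengthAt R (P ⧸ LZ) 𝔭 := by rw [hQN, hthird, hNeq, add_comm]
    _ ≤ lengthAt R (R ⧸ I) 𝔭 := hQI
    _ ≤ lengthAt R (R ⧸ Ideal.span {G}) 𝔭 := hIG

/-- **Kato, Thm. 17.4 (1)–(2), from Thm. 12.4, Thm. 12.5 (3), Thm. 16.6 + Prop. 17.11 and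
(17.13.1) — the module theory of §17.13, in Kato's printed (length) form.** Over a domain `R`
(for Kato `R = Λ = O_λ⟦G_∞⟧`, or a component of it), let `H →loc P →toX X →δ H2` be linear maps,
exact at `P` and at `X` (the Poitou–Tate sequence (17.13.1), with `P = H¹_loc(T(k))/H¹_loc(T'(k))`
by (17.13.3)); let `col : P → R` be injective (Prop. 17.11); let `H` be torsion free of rank `≤ 1`
and `H2` torsion (Thm. 12.4); let `Z ≤ H` (the zeta elements) and `G ≠ 0` with `G ∈ col (loc Z)`
(Thm. 16.6: the image of `Z(f,T)(k)_𝔭` is `Λ_𝔭 · L_{p-adic}`; `G` plays `L_{p-adic}` cleared of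
its `p`-power denominator, non-zero by Rohrlich). Then (1) `X` is a torsion `R`-module, and (2) at
every prime `𝔭` at which the Euler-system bound `length H2_𝔭 ≤ length (H/Z)_𝔭` of Thm. 12.5 (3)
holds, `length_{R_𝔭} X_𝔭 ≤ length_{R_𝔭} (R/(G))_𝔭 = ord_𝔭(G)`.
[cite: Kato2004, Thm 17.4 (1)(2) (p. 273) and §17.13 (pp. 279–280)] -/
theorem thm17_4_skeleton [Module.IsTorsionFree R H] (hrank : Module.rank R H ≤ 1)
    (loc : H →ₗ[R] P) (toX : P →ₗ[R] X) (δ : X →ₗ[R] H2)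
    (hPX : Function.Exact loc toX) (hXH : Function.Exact toX δ)
    (col : P →ₗ[R] R) (hcol : Function.Injective col) (hH2 : Module.IsTorsion R H2)
    (Z : Submodule R H) {G : R} (hG : G ≠ 0) (hGZ : G ∈ Submodule.map (col ∘ₗ loc) Z) :
    Module.IsTorsion R X ∧
      ∀ 𝔭 : PrimeSpectrum R, lengthAt R H2 𝔭 ≤ lengthAt R (H ⧸ Z) 𝔭 →
        lengthAt R X 𝔭 ≤ lengthAt R (R ⧸ Ideal.span {G}) 𝔭 := by
  obtain ⟨z, -, hz⟩ := Submodule.mem_map.mp hGZ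
  simp only [LinearMap.coe_comp, Function.comp_apply] at hz
  exact ⟨isTorsion_of_skeleton loc toX δ hPX hXH col hcol hG hz hH2,
    fun 𝔭 h𝔭 => lengthAt_le_of_skeleton hrank loc toX δ hPX hXH col hcol Z hG hGZ 𝔭 h𝔭⟩

end Skeleton

/-! ### Over `Λ = ℤ_p⟦T⟧`: the tree's form of the divisibility -/

section Iwasawa

variable (p : ℕ) [Fact p.Prime]
  {H P X H2 H2loc : Type*} [AddCommGroup H] [_root_.Module (IwasawaAlgebra p) H]
  [AddCommGroup P] [_root_.Module (IwasawaAlgebra p) P]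
  [AddCommGroup X] [_root_.Module (IwasawaAlgebra p) X]
  [AddCommGroup H2] [_root_.Module (IwasawaAlgebra p) H2]
  [AddCommGroup H2loc] [_root_.Module (IwasawaAlgebra p) H2loc]

/-- **Kato, Thm. 17.4 (1)–(2) for `Λ = ℤ_p⟦T⟧`, in the tree's form.** Hypotheses as in
`thm17_4_skeleton`, with `X` finitely generated, the Euler-system bound of Thm. 12.5 (3) in its
printed shape `length H2_𝔭 ≤ length (H/Z)_𝔭 + length (H2loc)_𝔭` at the height-one primes
`𝔭 ∌ p`, together with its "latter half" `(H2loc)_𝔭 = 0` there (`f` potentially good at `p`), and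
`ι G = p^n · L` in `ℚ_p⟦T⟧` (`L ∈ Λ ⊗ ℚ`, Thm. 17.4 (2)). Conclusion: `X` is `Λ`-torsion and
`p^m · L ∈ ι(char_Λ X)` for some `m`, i.e. conclusions 1–2 of `Literature.NumberTheory.EllipticCurves.kato_divisibility`
for an abstract `X` (bridge: `Module.exists_pow_mul_mem_charIdeal_of_lengthAt_le`).
[cite: Kato2004, Thm 17.4 (1)(2) (p. 273) and §17.13 (pp. 279–280)] -/
theorem exists_mem_charIdeal_of_skeleton [Module.Finite (IwasawaAlgebra p) X]
    [Module.IsTorsionFree (IwasawaAlgebra p) H] (hrank : Module.rank (IwasawaAlgebra p) H ≤ 1)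
    (loc : H →ₗ[IwasawaAlgebra p] P) (toX : P →ₗ[IwasawaAlgebra p] X)
    (δ : X →ₗ[IwasawaAlgebra p] H2)
    (hPX : Function.Exact loc toX) (hXH : Function.Exact toX δ)
    (col : P →ₗ[IwasawaAlgebra p] IwasawaAlgebra p) (hcol : Function.Injective col)
    (hH2 : Module.IsTorsion (IwasawaAlgebra p) H2)
    (Z : Submodule (IwasawaAlgebra p) H) {G : IwasawaAlgebra p} (hG : G ≠ 0)
    (hGZ : G ∈ Submodule.map (col ∘ₗ loc) Z)
    (hES : ∀ 𝔭 : PrimeSpectrum (IwasawaAlgebra p), 𝔭.asIdeal.height = 1 →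
      PowerSeries.C (p : ℤ_[p]) ∉ 𝔭.asIdeal →
        lengthAt (IwasawaAlgebra p) H2 𝔭 ≤
          lengthAt (IwasawaAlgebra p) (H ⧸ Z) 𝔭 + lengthAt (IwasawaAlgebra p) H2loc 𝔭)
    (hH2loc : ∀ 𝔭 : PrimeSpectrum (IwasawaAlgebra p), 𝔭.asIdeal.height = 1 →
      PowerSeries.C (p : ℤ_[p]) ∉ 𝔭.asIdeal → lengthAt (IwasawaAlgebra p) H2loc 𝔭 = 0)
    {L : PowerSeries ℚ_[p]} {n : ℕ}
    (hιG : iwasawaToPowerSeries p G = PowerSeries.C ((p : ℚ_[p]) ^ n) * L) :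
    Module.IsTorsion (IwasawaAlgebra p) X ∧
      ∃ (m : ℕ) (g : IwasawaAlgebra p), g ∈ charIdeal (IwasawaAlgebra p) X ∧
        iwasawaToPowerSeries p g = PowerSeries.C ((p : ℚ_[p]) ^ m) * L := by
  obtain ⟨htors, hlen⟩ := thm17_4_skeleton hrank loc toX δ hPX hXH col hcol hH2 Z hG hGZ
  refine ⟨htors, ?_⟩
  obtain ⟨m, hm⟩ := exists_pow_mul_mem_charIdeal_of_lengthAt_le htors (IwasawaAlgebra.prime_C p)
    hG fun 𝔭 h1 hp𝔭 => hlen 𝔭 (by simpa [hH2loc 𝔭 h1 hp𝔭] using hES 𝔭 h1 hp𝔭)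
  refine ⟨m + n, PowerSeries.C (p : ℤ_[p]) ^ m * G, hm, ?_⟩
  rw [map_mul, map_pow, hιG, PowerSeries.map_C, map_natCast, ← mul_assoc, ← map_pow, ← map_mul,
    ← pow_add]

end Iwasawa

/-! ### For `X = X(E/ℚ_∞)` and `L = L_p(E,T)`: conclusions 1–2 of `kato_divisibility` -/

section Selmer

variable (W : WeierstrassCurve ℚ) [W.IsElliptic] [W.IsGloballyMinimal] (p : ℕ) [Fact p.Prime]
  {κ : ZpExtension ℚ p} {γ : Field.absoluteGaloisGroup ℚ} {N : ℕ} [NeZero N]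
  {f : CuspForm (Gamma0 N) 2}
  {H P H2 H2loc : Type*} [AddCommGroup H] [_root_.Module (IwasawaAlgebra p) H]
  [AddCommGroup P] [_root_.Module (IwasawaAlgebra p) P]
  [AddCommGroup H2] [_root_.Module (IwasawaAlgebra p) H2]
  [AddCommGroup H2loc] [_root_.Module (IwasawaAlgebra p) H2loc]

/-- **Conclusions 1–2 of `kato_divisibility` (= Kato Thm. 17.4 (1)–(2) for `T_pE`) from the
four cohomological inputs of §17.13.** For `E/ℚ` (globally minimal `W`), `p` good ordinary
(`hord`), `f` its newform (`hf`), `κ` a cyclotomic `ℤ_p`-extension with topological generator `γ`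
and `D` a Pontryagin-dual datum for `Sel_{p^∞}(E/ℚ_∞)`: GIVEN `Λ`-modules `H, P, H2, H2loc`
(Kato's `H¹(T(k))`, `H¹_loc(T(k))/H¹_loc(T'(k))`, `H²(T(k))`, `H²_loc(T(k))` for `T ≅ T_pE(-1)`,
`k = 2`) with: the Poitou–Tate maps `H → P → D.X → H2` exact at `P` and `D.X` ((17.13.1) with
(17.10.1), (17.13.3)); `H` torsion free of rank `≤ 1` and `H2` torsion (Thm. 12.4); an injective
`col : P → Λ` (Prop. 17.11) and a submodule `Z ≤ H` whose image `col (loc Z)` contains `G` with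
`ι G = p^n L_p(E,T)` (Thm. 16.6, Thm. 17.4 (2) "`L_{p-adic} ∈ Λ ⊗ ℚ`"); and the Euler-system bound
of Thm. 12.5 (3) at the height-one `𝔭 ∌ p` with vanishing `H2loc`-term (good reduction at `p`) —
THEN `D.X` is `Λ`-torsion and `p^m L_p(E,T) = ι g` for some `g ∈ char_Λ D.X`. `G ≠ 0` is not
assumed: `L_p(E,T) ≠ 0` is the tree theorem `padicLFunction_unitRoot_ne_zero` (Rohrlich 1984).
[cite: Kato2004, Thm 17.4 (1)(2) (p. 273) and §17.13 (pp. 279–280)] -/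
theorem kato_divisibility_conclusions_of_skeleton (hord : IsOrdinaryAt W p) (hf : IsNewformOf W f)
    (hκ : κ.IsCyclotomic) (hγ : κ.IsTopGenerator γ) (D : W.SelmerDualData κ γ)
    [Module.IsTorsionFree (IwasawaAlgebra p) H] (hrank : Module.rank (IwasawaAlgebra p) H ≤ 1)
    (loc : H →ₗ[IwasawaAlgebra p] P) (toX : P →ₗ[IwasawaAlgebra p] D.X)
    (δ : D.X →ₗ[IwasawaAlgebra p] H2)
    (hPX : Function.Exact loc toX) (hXH : Function.Exact toX δ)
    (col : P →ₗ[IwasawaAlgebra p] IwasawaAlgebra p) (hcol : Function.Injective col)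
    (hH2 : Module.IsTorsion (IwasawaAlgebra p) H2)
    (Z : Submodule (IwasawaAlgebra p) H) {G : IwasawaAlgebra p}
    (hGZ : G ∈ Submodule.map (col ∘ₗ loc) Z)
    (hES : ∀ 𝔭 : PrimeSpectrum (IwasawaAlgebra p), 𝔭.asIdeal.height = 1 →
      PowerSeries.C (p : ℤ_[p]) ∉ 𝔭.asIdeal →
        lengthAt (IwasawaAlgebra p) H2 𝔭 ≤
          lengthAt (IwasawaAlgebra p) (H ⧸ Z) 𝔭 + lengthAt (IwasawaAlgebra p) H2loc 𝔭)
    (hH2loc : ∀ 𝔭 : PrimeSpectrum (IwasawaAlgebra p), 𝔭.asIdeal.height = 1 →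
      PowerSeries.C (p : ℤ_[p]) ∉ 𝔭.asIdeal → lengthAt (IwasawaAlgebra p) H2loc 𝔭 = 0)
    {n : ℕ} (hιG : iwasawaToPowerSeries p G =
      PowerSeries.C ((p : ℚ_[p]) ^ n) * padicLFunction f (unitRoot W p : ℚ_[p])) :
    D.IsTorsion ∧
      ∃ (m : ℕ) (g : IwasawaAlgebra p), g ∈ D.charIdeal ∧
        iwasawaToPowerSeries p g =
          PowerSeries.C ((p : ℚ_[p]) ^ m) * padicLFunction f (unitRoot W p : ℚ_[p]) := by
  haveI : Module.Finite (IwasawaAlgebra p) D.X := D.module_finite_of_isCyclotomic W κ hκ hγ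
  have hG : G ≠ 0 := by
    intro hG0
    have hL := padicLFunction_unitRoot_ne_zero hord hf
    have hpn : PowerSeries.C ((p : ℚ_[p]) ^ n) ≠ 0 := by
      rw [Ne, map_eq_zero_iff _ (PowerSeries.C_injective), pow_eq_zero_iff']
      exact fun h => (Nat.cast_ne_zero.mpr (Fact.out : p.Prime).ne_zero) h.1
    rw [hG0, map_zero, eq_comm, mul_eq_zero] at hιG
    exact hιG.elim hpn hL
  exact exists_mem_charIdeal_of_skeleton p hrank loc toX δ hPX hXH col hcol hH2 Z hG hGZ hES
    hH2loc hιG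

end Selmer

end Kato2004

/-! ### Thm. 18.4 (rank form) from Thm. 17.4 (1)–(2) only -/

section RankBound

variable (W : WeierstrassCurve ℚ) [W.IsElliptic] [W.IsGloballyMinimal] (p : ℕ) [Fact p.Prime]
  {N : ℕ} [NeZero N] {f : CuspForm (Gamma0 N) 2}

/-- **Kato Thm. 18.4 (rank form) from conclusions 1–2 of `kato_divisibility` alone.** If for
some cyclotomic `ℤ_p`-extension datum `κ` of `ℚ`, topological generator `γ` matching the cyclotomic
variable and Pontryagin-dual datum `D` for `Sel_{p^∞}(E/ℚ_∞)`, the Iwasawa module `D.X` is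
`Λ`-torsion and `p^n L_p(E,T) = ι g` with `g ∈ char_Λ D.X` (Kato, Thm. 17.4 (1)–(2)), then
`rank E(ℚ) ≤ ord_{T=0} L_p(E,T)`: `rank E(ℚ) ≤ ord_T g` (tree theorem
`WeierstrassCurve.mordellWeilRank_le_order_of_mem_charIdeal_of_isCyclotomic`: Greenberg's Lemma 3.1
+ the structure-theorem inequality) and `ord g ≤ ord (ι g) = ord (p^n L_p) = ord L_p`. The
integral refinement (conclusion 3 of `kato_divisibility`) is not used.
[cite: Kato2004, Thm 17.4 (p. 273) and Thm 18.4 (p. 281)] -/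
theorem kato_mordellWeilRank_le_order_padicLFunction_of_thm17_4
    (h : ∀ (_hp : p ≠ 2) (_hord : IsOrdinaryAt W p) (_hf : IsNewformOf W f),
      ∃ (κ : ZpExtension ℚ p) (γ : Field.absoluteGaloisGroup ℚ) (D : W.SelmerDualData κ γ),
        κ.IsCyclotomic ∧ κ.IsTopGenerator γ ∧ D.IsTorsion ∧
        ∃ (n : ℕ) (g : IwasawaAlgebra p), g ∈ D.charIdeal ∧
          iwasawaToPowerSeries p g =
            PowerSeries.C ((p : ℚ_[p]) ^ n) * padicLFunction f (unitRoot W p : ℚ_[p])) :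
    kato_mordellWeilRank_le_order_padicLFunction W p (f := f) := by
  intro hp hord hf
  obtain ⟨κ, γ, D, hκ, hγ, htors, n, g, hg, hιg⟩ := h hp hord hf
  have h1 : (W.mordellWeilRank : ℕ∞) ≤ PowerSeries.order g :=
    W.mordellWeilRank_le_order_of_mem_charIdeal_of_isCyclotomic hκ hγ D htors hg
  have h2 : PowerSeries.order g ≤ PowerSeries.order (iwasawaToPowerSeries p g) :=
    PowerSeries.le_order_map _
  have hpn : IsUnit (PowerSeries.C ((p : ℚ_[p]) ^ n)) := by
    refine IsUnit.map PowerSeries.C (IsUnit.mk0 _ (pow_ne_zero n ?_))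
    exact_mod_cast (Fact.out : p.Prime).ne_zero
  have h3 : PowerSeries.order (iwasawaToPowerSeries p g) =
      PowerSeries.order (padicLFunction f (unitRoot W p : ℚ_[p])) := by
    rw [hιg, PowerSeries.order_mul, PowerSeries.order_zero_of_unit hpn, zero_add]
  exact h3 ▸ h1.trans h2

/-- **What remains for the vendored Thm. 18.4.** For `E/ℚ`, an odd good ordinary `p` and the
newform `f` of `E`, the rank bound `kato_mordellWeilRank_le_order_padicLFunction W p` follows from
the four cohomological inputs of Kato's §17.13 on ONE cyclotomic datum `(κ, γ, D)` — the
Poitou–Tate maps `H → P → D.X → H2` exact at `P` and `D.X` ((17.13.1)), `H` torsion free of rank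
`≤ 1` and `H2` torsion (Thm. 12.4), an injective `col : P → Λ` with a zeta submodule `Z ≤ H` whose
image contains `G`, `ι G = p^n L_p(E,T)` (Prop. 17.11, Thm. 16.6), and the Euler-system bound of
Thm. 12.5 (3) at the height-one `𝔭 ∌ p` — everything else being theorems of the tree
(`Kato2004.kato_divisibility_conclusions_of_skeleton`, then `…_of_thm17_4`).
[cite: Kato2004, §17.13 (pp. 279–280), Thm 17.4 (p. 273) and Thm 18.4 (p. 281)] -/
theorem kato_mordellWeilRank_le_order_padicLFunction_of_skeleton
    {κ : ZpExtension ℚ p} {γ : Field.absoluteGaloisGroup ℚ}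
    {H P H2 H2loc : Type*} [AddCommGroup H] [_root_.Module (IwasawaAlgebra p) H]
    [AddCommGroup P] [_root_.Module (IwasawaAlgebra p) P]
    [AddCommGroup H2] [_root_.Module (IwasawaAlgebra p) H2]
    [AddCommGroup H2loc] [_root_.Module (IwasawaAlgebra p) H2loc]
    (hκ : κ.IsCyclotomic) (hγ : κ.IsTopGenerator γ) (D : W.SelmerDualData κ γ)
    [Module.IsTorsionFree (IwasawaAlgebra p) H] (hrank : Module.rank (IwasawaAlgebra p) H ≤ 1)
    (loc : H →ₗ[IwasawaAlgebra p] P) (toX : P →ₗ[IwasawaAlgebra p] D.X)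
    (δ : D.X →ₗ[IwasawaAlgebra p] H2)
    (hPX : Function.Exact loc toX) (hXH : Function.Exact toX δ)
    (col : P →ₗ[IwasawaAlgebra p] IwasawaAlgebra p) (hcol : Function.Injective col)
    (hH2 : Module.IsTorsion (IwasawaAlgebra p) H2)
    (Z : Submodule (IwasawaAlgebra p) H) {G : IwasawaAlgebra p}
    (hGZ : G ∈ Submodule.map (col ∘ₗ loc) Z)
    (hES : ∀ 𝔭 : PrimeSpectrum (IwasawaAlgebra p), 𝔭.asIdeal.height = 1 →
      PowerSeries.C (p : ℤ_[p]) ∉ 𝔭.asIdeal →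
        Module.lengthAt (IwasawaAlgebra p) H2 𝔭 ≤
          Module.lengthAt (IwasawaAlgebra p) (H ⧸ Z) 𝔭 +
            Module.lengthAt (IwasawaAlgebra p) H2loc 𝔭)
    (hH2loc : ∀ 𝔭 : PrimeSpectrum (IwasawaAlgebra p), 𝔭.asIdeal.height = 1 →
      PowerSeries.C (p : ℤ_[p]) ∉ 𝔭.asIdeal → Module.lengthAt (IwasawaAlgebra p) H2loc 𝔭 = 0)
    {n : ℕ} (hιG : iwasawaToPowerSeries p G =
      PowerSeries.C ((p : ℚ_[p]) ^ n) * padicLFunction f (unitRoot W p : ℚ_[p])) :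
    kato_mordellWeilRank_le_order_padicLFunction W p (f := f) :=
  kato_mordellWeilRank_le_order_padicLFunction_of_thm17_4 W p fun _ hord hf =>
    have h := Kato2004.kato_divisibility_conclusions_of_skeleton W p hord hf hκ hγ D hrank loc toX
      δ hPX hXH col hcol hH2 Z hGZ hES hH2loc hιG
    ⟨κ, γ, D, hκ, hγ, h.1, h.2⟩

omit [W.IsElliptic] in
/-- The tree's `kato_divisibility` (Kato Thm. 17.4 with the integral refinement) implies the
hypothesis of `kato_mordellWeilRank_le_order_padicLFunction_of_thm17_4` — its conclusions 1–2 on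
the cyclotomic datum of `exists_isCyclotomic_isTopGenerator_isCyclotomicVariable_holds` and the dual
datum of `WeierstrassCurve.nonempty_selmerDualData_holds`. Composed with
`kato_mordellWeilRank_le_order_padicLFunction_of_thm17_4` it re-proves, through the Thm. 17.4
(1)–(2) route, the rank bound `kato_mordellWeilRank_le_order_padicLFunction_of_kato_divisibility`
(file `KatoRankBoundProofs`). [cite: Kato2004, Thm 17.4 (p. 273)] -/
theorem kato_divisibility.thm17_4
    (hkato : ∀ (κ : ZpExtension ℚ p) (γ : Field.absoluteGaloisGroup ℚ),
      kato_divisibility W p (κ := κ) (γ := γ) (f := f))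
    (hp : p ≠ 2) (hord : IsOrdinaryAt W p) (hf : IsNewformOf W f) :
    ∃ (κ : ZpExtension ℚ p) (γ : Field.absoluteGaloisGroup ℚ) (D : W.SelmerDualData κ γ),
      κ.IsCyclotomic ∧ κ.IsTopGenerator γ ∧ D.IsTorsion ∧
      ∃ (n : ℕ) (g : IwasawaAlgebra p), g ∈ D.charIdeal ∧
        iwasawaToPowerSeries p g =
          PowerSeries.C ((p : ℚ_[p]) ^ n) * padicLFunction f (unitRoot W p : ℚ_[p]) := by
  obtain ⟨κ, hκ, γ, hγ, hγ'⟩ := exists_isCyclotomic_isTopGenerator_isCyclotomicVariable_holds p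
  obtain ⟨D⟩ := W.nonempty_selmerDualData_holds κ γ hγ
  obtain ⟨htors, ⟨n, g, hg, hιg⟩, -⟩ := hkato κ γ hp hord hκ hγ hγ' hf D
  exact ⟨κ, γ, D, hκ, hγ, htors, n, g, hg, hιg⟩

end RankBound

end Literature.NumberTheory.EllipticCurves
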